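import Summits.CriticalPhenomena.CardyFormulaZ2.Theorems.CardyMagicRigidityPinchResamplingDefs
import Literature.Probability.Percolation.AnnulusCrossingBoundProofs
import Literature.Probability.Percolation.SharpnessDCTProofs
import Literature.Probability.Percolation.SlabCriticality
import Literature.Probability.Percolation.FiniteEnergy
import Literature.Probability.Percolation.PercolationEvents
import Literature.Probability.Percolation.SitePaths
import Literature.Probability.Percolation.Crossings
import HarnessLib

/-!
# Crux `NestingRigidity`, line `pinch-resampling` (v2), stub S3 `stub_fourArmCouplingZ2`:
# locality of the pinch event on `ℤ²` and the exact regime `m = s` of `FourArmCouplingZ2`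

Crux `Summit.CriticalPhenomena.CardyFormulaZ2.Theses.CardyMagicRigidity.NestingRigidity`
(stmt-CriticalPhenomena-4835), line `pinch-resampling` v2 (vocabulary `CardyMagicRigidityPinchResamplingDefs`),
stub S3 `stub_fourArmCouplingZ2 : FourArmCouplingZ2` (exterior forgetting for critical bond percolation on `ℤ²`,
primal / dual arms from the Φ-symmetric medial gadget).  This file is the TYPING AUDIT of the statement in
Lean and its exact (trivial) regime; the genuine content of S3 (`m < s ≪ n`, the Garban–Pete–Schramm coupling
property, asserted for `ℤ²` in arXiv:1008.1378 §1) is NOT touched here.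

* §1–§2 The annulus predicates `IsCrossing`, `TwoCrossingClusters`, `HookedUp` read the colour graph only
  through its adjacency inside the annulus `O ∖ I` (resp. `O`); hence `{ω | TwoCrossingClusters G (openGraph ω)
  I O}` is determined by the pairs `(O ∖ I).sym2` (NB `openGraph ω = fromEdgeSet ω` also reads the NON-lattice
  pairs of `ω` — `P_p`-a.s. closed, but they enter the sure-event notion `DeterminedBy`) and its dual version
  by `dualEdge ⁻¹' (O ∖ I).sym2` (`DeterminedBy.preimage_dualConfig`).
* §3 Gadget geometry: `Λ_s(y) ⊆ zMedBlock y s`, `Λ_s(y) ⊆ zMedDualBlock y s`, `Λ_s(y) ⊆ Λ_n(x)` for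
  `|y - x|_∞ + s ≤ n`; the boxes are finite; every pair shares a vertex with its dual pair.
* §4 (B1/B2) `ZPinch x y m n` is determined by the finite pair set
  `(Λ_{2n}(x) ∖ zMedBlock y m).sym2 ∪ dualEdge ⁻¹' (zDualBall x (2n) ∖ zMedDualBlock y m).sym2` and is
  measurable (so is `ZHook`).  This set is DISJOINT from the interior pairs `zIntEdges y s` when `m = s`, NOT
  from the exterior pairs `zExtEdges x n` (the pinch annulus reaches radius `2n > n`:
  `not_disjoint_zPinchEdges_zExtEdges`); exterior and interior pairs are disjoint once `|y - x|_∞ + s ≤ n`.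
* §5 (B3) the EXACT REGIME, registered helper `fourArmCouplingZ2_self`: for `m = s` (containing the case
  `s = 0` of `FourArmCouplingZ2`, as `m ≤ s`) the interior σ-field is independent of `ZPinch x y s n ∩ F` for
  every exterior event `F` (product measure, `bondPercolation_real_inter_of_disjoint`), so
  `P(E ∩ Pinch ∩ F) = P(E) · P(Pinch ∩ F)` and the cross-multiplied difference of `FourArmCouplingZ2` vanishes:
  the inequality holds for ANY `b ≥ 0`, with no constraint `M s ≤ n`.

What remains of S3 is exactly the regime `m < s`: the coupling property proper.
-/

noncomputable section

namespace Summit.CriticalPhenomena.CardyFormulaZ2.Cruxes.NestingRigidity.PinchResampling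

open MeasureTheory Literature.Probability.Percolation Literature.Probability.LatticeModels

/-! ## §1 The annulus predicates only read the adjacency inside the annulus -/

namespace ZPinchLocality

section Congr

variable {V : Type*}

/-- `PathIn G A u v` only reads the adjacency of `G` between vertices of `A`. -/
theorem pathIn_congr {G G' : SimpleGraph V} {A : Set V}
    (hadj : ∀ a b, a ∈ A → b ∈ A → (G.Adj a b ↔ G'.Adj a b)) (u v : V) :
    PathIn G A u v ↔ PathIn G' A u v :=
  ⟨DCT16.pathIn_congrGraph fun a b ha hb h ↦ (hadj a b ha hb).1 h,
    DCT16.pathIn_congrGraph fun a b ha hb h ↦ (hadj a b ha hb).2 h⟩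

/-- `IsCrossing G H I O v` only reads the adjacency of the colour graph `H` inside the annulus `O ∖ I`. -/
theorem isCrossing_congr {G H H' : SimpleGraph V} {I O : Set V}
    (hadj : ∀ a b, a ∈ O \ I → b ∈ O \ I → (H.Adj a b ↔ H'.Adj a b)) (v : V) :
    IsCrossing G H I O v ↔ IsCrossing G H' I O v := by
  simp only [IsCrossing, pathIn_congr hadj]

/-- `TwoCrossingClusters G H I O` only reads the adjacency of `H` inside the annulus `O ∖ I`. -/
theorem twoCrossingClusters_congr {G H H' : SimpleGraph V} {I O : Set V}
    (hadj : ∀ a b, a ∈ O \ I → b ∈ O \ I → (H.Adj a b ↔ H'.Adj a b)) :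
    TwoCrossingClusters G H I O ↔ TwoCrossingClusters G H' I O := by
  simp only [TwoCrossingClusters, isCrossing_congr hadj, pathIn_congr hadj]

/-- `HookedUp G H I O` only reads the adjacency of `H` inside the big region `O`. -/
theorem hookedUp_congr {G H H' : SimpleGraph V} {I O : Set V}
    (hadj : ∀ a b, a ∈ O → b ∈ O → (H.Adj a b ↔ H'.Adj a b)) :
    HookedUp G H I O ↔ HookedUp G H' I O := by
  have hadj' : ∀ a b, a ∈ O \ I → b ∈ O \ I → (H.Adj a b ↔ H'.Adj a b) :=
    fun a b ha hb ↦ hadj a b ha.1 hb.1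
  simp only [HookedUp, isCrossing_congr hadj', pathIn_congr hadj]

end Congr

/-! ## §2 Determining pair sets of the annulus events (bond configurations) -/

section Determined

variable {V : Type*}

/-- Configurations agreeing on a pair set containing `A.sym2` have the same open edges inside `A`. -/
theorem openGraph_adj_congr_of_inter_eq {ω ω' : BondConfig V} {A : Set V} {K : Set (Sym2 V)}
    (hK : A.sym2 ⊆ K) (h : ω ∩ K = ω' ∩ K) :
    ∀ a b, a ∈ A → b ∈ A → ((openGraph ω).Adj a b ↔ (openGraph ω').Adj a b) :=
  fun _ _ ha hb ↦ DCT16.openGraph_adj_congr h (hK (Set.mk_mem_sym2_iff.2 ⟨ha, hb⟩))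

/-- **"Exactly two open crossing clusters of `O ∖ I`" is determined by the pairs inside the annulus.** -/
theorem determinedBy_twoCrossingClusters (G : SimpleGraph V) (I O : Set V) {K : Set (Sym2 V)}
    (hK : (O \ I).sym2 ⊆ K) :
    DeterminedBy {ω : BondConfig V | TwoCrossingClusters G (openGraph ω) I O} K := by
  rw [determinedBy_iff]
  intro ω ω' h
  exact twoCrossingClusters_congr (openGraph_adj_congr_of_inter_eq hK h)

/-- **The open hook-up of `O ∖ I` is determined by the pairs inside `O`.** -/
theorem determinedBy_hookedUp (G : SimpleGraph V) (I O : Set V) {K : Set (Sym2 V)}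
    (hK : O.sym2 ⊆ K) :
    DeterminedBy {ω : BondConfig V | HookedUp G (openGraph ω) I O} K := by
  rw [determinedBy_iff]
  intro ω ω' h
  exact hookedUp_congr (openGraph_adj_congr_of_inter_eq hK h)

/-- **"Exactly two dual-open crossing clusters of the dual annulus `O ∖ I`" is determined by the
`dualEdge`-preimages of the pairs inside the dual annulus** (`DeterminedBy.preimage_dualConfig`). -/
theorem determinedBy_twoCrossingClusters_dualConfig (I O : Set (Site 2)) {K : Set (Sym2 (Site 2))}
    (hK : dualEdge ⁻¹' (O \ I).sym2 ⊆ K) :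
    DeterminedBy
      {ω : BondConfig (Site 2) | TwoCrossingClusters (zdGraph 2) (openGraph (dualConfig ω)) I O} K :=
  (DeterminedBy.preimage_dualConfig
    (determinedBy_twoCrossingClusters (zdGraph 2) I O Set.Subset.rfl)).mono hK

/-- **The dual hook-up is determined by the `dualEdge`-preimages of the pairs inside `O`.** -/
theorem determinedBy_hookedUp_dualConfig (I O : Set (Site 2)) {K : Set (Sym2 (Site 2))}
    (hK : dualEdge ⁻¹' O.sym2 ⊆ K) :
    DeterminedBy {ω : BondConfig (Site 2) | HookedUp (zdGraph 2) (openGraph (dualConfig ω)) I O} K :=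
  (DeterminedBy.preimage_dualConfig (determinedBy_hookedUp (zdGraph 2) I O Set.Subset.rfl)).mono hK

/-- A pair with a vertex in `B` is not a pair of the annulus `O ∖ B`. -/
theorem not_mem_sym2_diff {B O : Set V} {e : Sym2 V} {v : V} (hv : v ∈ e) (hvB : v ∈ B) :
    e ∉ (O \ B).sym2 :=
  fun h ↦ (Set.mem_sym2_iff_subset.1 h hv).2 hvB

end Determined

end ZPinchLocality

open ZPinchLocality

/-! ## §3 Lattice geometry of the boxes and of the Φ-symmetric gadget -/

section Geometry

/-- The sup norm of a difference, in coordinates. -/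
theorem zNorm_sub (v x : Site 2) : zNorm (v - x) = max |v 0 - x 0| |v 1 - x 1| := rfl

/-- The sup norm is nonnegative. -/
theorem zNorm_nonneg (v : Site 2) : 0 ≤ zNorm v := (abs_nonneg _).trans (le_max_left _ _)

/-- Membership in the primal box `Λ_n(x)`, in coordinates. -/
theorem mem_zBall_iff {x v : Site 2} {n : ℕ} :
    v ∈ zBall x n ↔ |v 0 - x 0| ≤ n ∧ |v 1 - x 1| ≤ n := by
  simp only [zBall, zNorm_sub, Set.mem_setOf_eq, max_le_iff]

/-- Membership in the dual box of radius `n + ½` about `x`, in coordinates. -/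
theorem mem_zDualBall_iff {x v : Site 2} {n : ℕ} :
    v ∈ zDualBall x n ↔ |2 * (v 0 - x 0) + 1| ≤ 2 * n + 1 ∧ |2 * (v 1 - x 1) + 1| ≤ 2 * n + 1 := by
  simp only [zDualBall, zNorm, Set.mem_setOf_eq, nsmul_eq_mul, Nat.cast_ofNat, Pi.add_apply,
    Pi.mul_apply, Pi.sub_apply, Pi.ofNat_apply, max_le_iff]

/-- **The primal gadget block contains the box of the same size**: `Λ_s(y) ⊆ zMedBlock y s`. -/
theorem zBall_subset_zMedBlock (y : Site 2) (s : ℕ) : zBall y s ⊆ zMedBlock y s := by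
  intro v hv
  rw [mem_zBall_iff] at hv
  simp only [abs_le] at hv
  simp only [zMedBlock, Set.mem_setOf_eq, abs_le]
  omega

/-- **The dual gadget block contains the box of the same size**: `Λ_s(y) ⊆ zMedDualBlock y s`
(lower-left-corner indexing of dual vertices). -/
theorem zBall_subset_zMedDualBlock (y : Site 2) (s : ℕ) : zBall y s ⊆ zMedDualBlock y s := by
  intro v hv
  rw [mem_zBall_iff] at hv
  simp only [abs_le] at hv
  simp only [zMedDualBlock, Set.mem_setOf_eq, abs_le]
  omega

/-- Nested boxes: `Λ_s(y) ⊆ Λ_n(x)` as soon as `|y - x|_∞ + s ≤ n`. -/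
theorem zBall_subset_zBall {x y : Site 2} {s n : ℕ} (h : zNorm (y - x) + s ≤ n) :
    zBall y s ⊆ zBall x n := by
  intro v hv
  rw [mem_zBall_iff] at hv ⊢
  have h0 : |y 0 - x 0| ≤ zNorm (y - x) := le_max_left _ _
  have h1 : |y 1 - x 1| ≤ zNorm (y - x) := le_max_right _ _
  simp only [abs_le] at hv h0 h1 ⊢
  omega

/-- The hypothesis `2 |y - x|_∞ + 2 s ≤ n` of `FourArmCouplingZ2` implies `|y - x|_∞ + s ≤ n`. -/
theorem zNorm_add_le_of_two_mul {x y : Site 2} {s n : ℕ} (h : 2 * zNorm (y - x) + 2 * s ≤ n) :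
    zNorm (y - x) + s ≤ n := by
  have := zNorm_nonneg (y - x)
  omega

/-- The primal box `Λ_n(x)` is finite. -/
theorem zBall_finite (x : Site 2) (n : ℕ) : (zBall x n).Finite := by
  refine (Set.finite_Icc (x - fun _ ↦ (n : ℤ)) (x + fun _ ↦ (n : ℤ))).subset fun v hv ↦ ?_
  rw [mem_zBall_iff] at hv
  simp only [abs_le] at hv
  rw [Set.mem_Icc, Pi.le_def, Pi.le_def]
  refine ⟨fun i ↦ ?_, fun i ↦ ?_⟩
  · fin_cases i <;> simp only [Pi.sub_apply, Fin.zero_eta, Fin.mk_one, Fin.isValue] <;> omega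
  · fin_cases i <;> simp only [Pi.add_apply, Fin.zero_eta, Fin.mk_one, Fin.isValue] <;> omega

/-- The dual box of radius `n + ½` is finite. -/
theorem zDualBall_finite (x : Site 2) (n : ℕ) : (zDualBall x n).Finite := by
  refine (Set.finite_Icc (x - fun _ ↦ (n : ℤ) + 1) (x + fun _ ↦ (n : ℤ))).subset fun v hv ↦ ?_
  rw [mem_zDualBall_iff] at hv
  simp only [abs_le] at hv
  rw [Set.mem_Icc, Pi.le_def, Pi.le_def]
  refine ⟨fun i ↦ ?_, fun i ↦ ?_⟩
  · fin_cases i <;> simp only [Pi.sub_apply, Fin.zero_eta, Fin.mk_one, Fin.isValue] <;> omega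
  · fin_cases i <;> simp only [Pi.add_apply, Fin.zero_eta, Fin.mk_one, Fin.isValue] <;> omega

/-- **Every pair shares a vertex with its dual pair**: for a lattice edge `{u, u + eᵢ}` the lower-left
endpoint `u` is also a (lower-left-corner index of a) dual endpoint of `dualEdge {u, u + eᵢ}`
(`dualEdge_horizontal`, `dualEdge_vertical`); off the edge set `dualEdge` is the identity. -/
theorem exists_mem_mem_dualEdge (e : Sym2 (Site 2)) : ∃ v ∈ e, v ∈ dualEdge e := by
  by_cases he : e ∈ (zdGraph 2).edgeSet
  · obtain ⟨u, i, rfl⟩ := mem_edgeSet_zdGraph_iff.1 he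
    refine ⟨u, Sym2.mem_mk_left _ _, ?_⟩
    fin_cases i
    · simp only [Fin.zero_eta]
      rw [dualEdge_horizontal]
      exact Sym2.mem_mk_right _ _
    · simp only [Fin.mk_one]
      rw [dualEdge_vertical]
      exact Sym2.mem_mk_right _ _
  · exact ⟨e.out.1, Sym2.out_fst_mem e, by rw [dualEdge_of_not_mem he]; exact Sym2.out_fst_mem e⟩

end Geometry

/-! ## §4 B1/B2: determining pair sets of `ZPinch`, `ZHook`; measurability; disjointness -/

section Pinch

/-- `ZPinch` is the intersection of its primal half and its dual half (definitional). -/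
theorem zPinch_eq_inter (x y : Site 2) (m n : ℕ) :
    ZPinch x y m n =
      {ω | TwoCrossingClusters (zdGraph 2) (openGraph ω) (zMedBlock y m) (zBall x (2 * n))} ∩
        {ω | TwoCrossingClusters (zdGraph 2) (openGraph (dualConfig ω)) (zMedDualBlock y m)
          (zDualBall x (2 * n))} :=
  rfl

/-- **B1. The determining pair set of the pinch event**: `ZPinch x y m n` is determined by the pairs
inside the primal annulus `Λ_{2n}(x) ∖ zMedBlock y m` together with the `dualEdge`-preimages of the pairs
inside the dual annulus `zDualBall x (2n) ∖ zMedDualBlock y m`. -/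
theorem zPinch_determinedBy (x y : Site 2) (m n : ℕ) :
    DeterminedBy (ZPinch x y m n)
      ((zBall x (2 * n) \ zMedBlock y m).sym2 ∪
        dualEdge ⁻¹' (zDualBall x (2 * n) \ zMedDualBlock y m).sym2) := by
  rw [zPinch_eq_inter]
  exact (determinedBy_twoCrossingClusters (zdGraph 2) (zMedBlock y m) (zBall x (2 * n))
    Set.subset_union_left).inter
    (determinedBy_twoCrossingClusters_dualConfig (zMedDualBlock y m) (zDualBall x (2 * n))
      Set.subset_union_right)

/-- The determining pair set of `ZPinch x y m n` is finite (`dualEdge` is injective). -/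
theorem zPinchEdges_finite (x y : Site 2) (m n : ℕ) :
    ((zBall x (2 * n) \ zMedBlock y m).sym2 ∪
        dualEdge ⁻¹' (zDualBall x (2 * n) \ zMedDualBlock y m).sym2).Finite :=
  (finite_sym2 ((zBall_finite x _).subset fun _ h ↦ h.1)).union
    (Set.Finite.preimage dualEdge_bijective.injective.injOn
      (finite_sym2 ((zDualBall_finite x _).subset fun _ h ↦ h.1)))

/-- **B1. The pinch event is measurable** (a cylinder event on finitely many pairs). -/
theorem measurableSet_zPinch (x y : Site 2) (m n : ℕ) : MeasurableSet (ZPinch x y m n) := by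
  have h := zPinch_determinedBy x y m n
  rw [← (zPinchEdges_finite x y m n).coe_toFinset] at h
  exact h.measurableSet_of_finset

/-- The determining pair set of the primal hook-up: the pairs inside `Λ_{2n}(x)`. -/
theorem zHook_determinedBy (x y : Site 2) (m n : ℕ) :
    DeterminedBy (ZHook x y m n) (zBall x (2 * n)).sym2 :=
  determinedBy_hookedUp (zdGraph 2) (zMedBlock y m) (zBall x (2 * n)) Set.Subset.rfl

/-- The primal hook-up is measurable. -/
theorem measurableSet_zHook (x y : Site 2) (m n : ℕ) : MeasurableSet (ZHook x y m n) := by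
  have h := zHook_determinedBy x y m n
  rw [← (finite_sym2 (zBall_finite x (2 * n))).coe_toFinset] at h
  exact h.measurableSet_of_finset

/-- **B2. For `m = s` the pinch event does not read the interior pairs**: the determining pair set of
`ZPinch x y s n` is disjoint from `zIntEdges y s` (the primal gadget block contains `Λ_s(y)`, and every
pair inside `Λ_s(y)` shares a vertex with its dual pair, which lies in the dual gadget block). -/
theorem disjoint_zPinchEdges_zIntEdges (x y : Site 2) (s n : ℕ) :
    Disjoint ((zBall x (2 * n) \ zMedBlock y s).sym2 ∪
        dualEdge ⁻¹' (zDualBall x (2 * n) \ zMedDualBlock y s).sym2) (zIntEdges y s) := by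
  refine Set.disjoint_left.2 fun e he hint ↦ ?_
  have hint' : ∀ v ∈ e, v ∈ zBall y s := hint
  rcases he with he | he
  · exact not_mem_sym2_diff (Sym2.out_fst_mem e)
      (zBall_subset_zMedBlock y s (hint' _ (Sym2.out_fst_mem e))) he
  · obtain ⟨v, hv, hvd⟩ := exists_mem_mem_dualEdge e
    exact not_mem_sym2_diff hvd (zBall_subset_zMedDualBlock y s (hint' v hv)) he

/-- **B2. Exterior and interior pairs are disjoint** once `Λ_s(y) ⊆ Λ_n(x)`, i.e. `|y - x|_∞ + s ≤ n`. -/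
theorem disjoint_zExtEdges_zIntEdges {x y : Site 2} {s n : ℕ} (h : zNorm (y - x) + s ≤ n) :
    Disjoint (zExtEdges x n) (zIntEdges y s) := by
  refine Set.disjoint_left.2 fun e hext hint ↦ ?_
  have hint' : ∀ v ∈ e, v ∈ zBall y s := hint
  have hext' : ∀ v ∈ e, v ∉ zBall x n := hext
  exact hext' _ (Sym2.out_fst_mem e) (zBall_subset_zBall h (hint' _ (Sym2.out_fst_mem e)))

/-- Coordinates of the horizontal shift `x + k e₀` relative to `x`. -/
theorem shift_single_zero_sub (x : Site 2) (k : ℤ) :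
    (x + Pi.single (0 : Fin 2) k : Site 2) 0 - x 0 = k ∧
      (x + Pi.single (0 : Fin 2) k : Site 2) 1 - x 1 = 0 := by
  simp

/-- **B2, negative half (recorded, not used): the pinch DOES read exterior pairs** — its determining pair
set meets `zExtEdges x n` (the pinch annulus reaches radius `2n > n`); instance `y = x`, `m + 2 ≤ n`,
witnessed by the lattice edge from `x + (n+1) e₀` to `x + (n+2) e₀`. -/
theorem not_disjoint_zPinchEdges_zExtEdges (x : Site 2) {m n : ℕ} (hmn : m + 2 ≤ n) :
    ¬ Disjoint ((zBall x (2 * n) \ zMedBlock x m).sym2 ∪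
        dualEdge ⁻¹' (zDualBall x (2 * n) \ zMedDualBlock x m).sym2) (zExtEdges x n) := by
  rw [Set.not_disjoint_iff]
  have key : ∀ k : ℤ, (n : ℤ) < k → k ≤ 2 * n →
      x + Pi.single 0 k ∈ zBall x (2 * n) \ zMedBlock x m ∧ x + Pi.single 0 k ∉ zBall x n := by
    intro k hk₁ hk₂
    obtain ⟨h0, h1⟩ := shift_single_zero_sub x k
    refine ⟨⟨?_, ?_⟩, ?_⟩
    · rw [mem_zBall_iff, h0, h1]
      simp only [abs_le, abs_zero, Nat.cast_mul, Nat.cast_ofNat]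
      omega
    · simp only [zMedBlock, Set.mem_setOf_eq, h0, h1, abs_zero]
      omega
    · rw [mem_zBall_iff, h0, h1]
      simp only [abs_le, abs_zero]
      omega
  refine ⟨s(x + Pi.single 0 ((n : ℤ) + 1), x + Pi.single 0 ((n : ℤ) + 2)), Or.inl ?_, fun v hv ↦ ?_⟩
  · exact Set.mk_mem_sym2_iff.2 ⟨(key _ (by omega) (by omega)).1, (key _ (by omega) (by omega)).1⟩
  · rcases Sym2.mem_iff.1 hv with rfl | rfl
    · exact (key _ (by omega) (by omega)).2
    · exact (key _ (by omega) (by omega)).2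

end Pinch

/-! ## §5 B3: the exact regime `m = s` (and `s = 0`) of `FourArmCouplingZ2` -/

section Exact

/-- **Interior events are independent of the pinch seen through an exterior event, when `m = s`.**
For `|y - x|_∞ + s ≤ n`, an event `E` determined by the pairs inside `Λ_s(y)` and any measurable `F`
determined by the pairs off `Λ_n(x)`:  `P(E ∩ Pinch(x,y;s,n) ∩ F) = P(E) · P(Pinch(x,y;s,n) ∩ F)` under
`P = P_{1/2}` on `ℤ²` (product measure over disjoint pair sets). -/
theorem real_inter_zPinch_inter {x y : Site 2} {s n : ℕ} (h : zNorm (y - x) + s ≤ n)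
    {F E : Set (BondConfig (Site 2))} (hFm : MeasurableSet F) (hF : DeterminedBy F (zExtEdges x n))
    (hEm : MeasurableSet E) (hE : DeterminedBy E (zIntEdges y s)) :
    (bondPercolation (zdGraph 2) half).real (E ∩ ZPinch x y s n ∩ F) =
      (bondPercolation (zdGraph 2) half).real E *
        (bondPercolation (zdGraph 2) half).real (ZPinch x y s n ∩ F) := by
  rw [Set.inter_assoc]
  refine bondPercolation_real_inter_of_disjoint (zdGraph 2) half ?_ hE
    (((zPinch_determinedBy x y s n).mono Set.subset_union_left).inter
      (hF.mono Set.subset_union_right))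
    hEm ((measurableSet_zPinch x y s n).inter hFm)
  exact (Set.disjoint_union_left.2
    ⟨disjoint_zPinchEdges_zIntEdges x y s n, disjoint_zExtEdges_zIntEdges h⟩).symm

/-- **B3 — the exact regime of `FourArmCouplingZ2` (registered helper toward stub S3
`stub_fourArmCouplingZ2`).**  When the gadget size equals the interior radius, `m = s` (in particular in
the case `s = 0` of `FourArmCouplingZ2`, where `m ≤ s` forces `m = 0`), the conditional law of the
interior pairs `zIntEdges y s` given `Pinch ∩ F` is their unconditional law for EVERY exterior event `F`
(`real_inter_zPinch_inter`), so the cross-multiplied difference of `FourArmCouplingZ2` vanishes and the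
inequality holds for every `b ≥ 0`, with no lower bound on `n / s` (only `Λ_s(y) ⊆ Λ_n(x)` is used). -/
theorem fourArmCouplingZ2_self : ∀ b : ℝ, 0 ≤ b → ∀ (x y : Site 2) (s n : ℕ), zNorm (y - x) + s ≤ n → ∀ F F' : Set (BondConfig (Site 2)), MeasurableSet F → MeasurableSet F' → DeterminedBy F (zExtEdges x n) → DeterminedBy F' (zExtEdges x n) → ∀ E : Set (BondConfig (Site 2)), MeasurableSet E → DeterminedBy E (zIntEdges y s) → |(bondPercolation (zdGraph 2) half).real (E ∩ ZPinch x y s n ∩ F) * (bondPercolation (zdGraph 2) half).real (ZPinch x y s n ∩ F') - (bondPercolation (zdGraph 2) half).real (E ∩ ZPinch x y s n ∩ F') * (bondPercolation (zdGraph 2) half).real (ZPinch x y s n ∩ F)| ≤ b * (bondPercolation (zdGraph 2) half).real (ZPinch x y s n ∩ F) * (bondPercolation (zdGraph 2) half).real (ZPinch x y s n ∩ F') := by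
  intro b hb x y s n hn F F' hFm hF'm hF hF' E hEm hE
  rw [real_inter_zPinch_inter hn hFm hF hEm hE, real_inter_zPinch_inter hn hF'm hF' hEm hE]
  rw [mul_right_comm _ ((bondPercolation (zdGraph 2) half).real (ZPinch x y s n ∩ F')), sub_self, abs_zero]
  positivity

/-- **The two exact regimes inside the statement `FourArmCouplingZ2`**: its conclusion holds (for every
`b ≥ 0`, whatever `M`) whenever `m = s` or `s = 0`, under its own hypotheses `m ≤ s` and
`2 |y - x|_∞ + 2 s ≤ n`. -/
theorem fourArmCouplingZ2_of_eq_or_eq_zero {b : ℝ} (hb : 0 ≤ b) {x y : Site 2} {m s n : ℕ}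
    (hdeg : m = s ∨ s = 0) (hms : m ≤ s) (hn : 2 * zNorm (y - x) + 2 * s ≤ n)
    {F F' : Set (BondConfig (Site 2))} (hFm : MeasurableSet F) (hF'm : MeasurableSet F')
    (hF : DeterminedBy F (zExtEdges x n)) (hF' : DeterminedBy F' (zExtEdges x n))
    {E : Set (BondConfig (Site 2))} (hEm : MeasurableSet E) (hE : DeterminedBy E (zIntEdges y s)) :
    |(bondPercolation (zdGraph 2) half).real (E ∩ ZPinch x y m n ∩ F) *
          (bondPercolation (zdGraph 2) half).real (ZPinch x y m n ∩ F') -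
        (bondPercolation (zdGraph 2) half).real (E ∩ ZPinch x y m n ∩ F') *
          (bondPercolation (zdGraph 2) half).real (ZPinch x y m n ∩ F)| ≤
      b * (bondPercolation (zdGraph 2) half).real (ZPinch x y m n ∩ F) *
        (bondPercolation (zdGraph 2) half).real (ZPinch x y m n ∩ F') := by
  obtain rfl : m = s := by omega
  exact fourArmCouplingZ2_self b hb x y m n (zNorm_add_le_of_two_mul hn) F F' hFm hF'm hF hF' E hEm hE

end Exact

end Summit.CriticalPhenomena.CardyFormulaZ2.Cruxes.NestingRigidity.PinchResampling

end
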